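import Summits.MatrixMultiplication.MatrixMultiplication.Theses.SnSubsetDichotomy

/-!
# Line `tight-host-split` for crux `GlobalBranch` (stmt-MatrixMultiplication-8303) — crux-strategist skeleton (v1, 2026-08-17)

WALL-BREAKER LINE on an exhausted chain.  The three earlier lines (`bregman-entropy-window`,
`young-host-squeeze`, `flat-tail-truncation`, merged skeleton v8) are complete PRE-FILTERS: every stub landed
and their joint residual R7 is equivalent to the crux (`Lines/bregman-entropy-window-dead.md`).  This line does
not pre-filter.  It cuts the crux into the two objects that three independent seats named as what a surviving
line must START from (RESIDUAL-c3 §3–4, dead-line dossier §5, PICKED c4), each a registered stub of crux size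
(promotion to sub-cruxes is the intended fate; the formal `route edit --split` with the same two statements is
prepared in the strategist's folder as `children.json` and was refused only by the final-cycle rule):

* `stub_inverseHostCapture` — the INVERSE THEOREM at density `(n!)^{-1/2}`: for some `ε > 0` and every rate
  `c' > 0` there is `c > 0` such that in a `(1/2+ε)`-bump-free TPP triple ABOVE `(n!)^{3/2}e^{-c√n}` each of
  the three sets has an `e^{-c'√n}`-fraction inside ONE tight host coset;
* `stub_tightHostedSubsets` — the HOSTED PROBLEM: TPP triples of tightly hosted sets are sub-threshold
  (no bump-free hypothesis), where a tight host coset is a block transporter `{σ : σ(P) = B}`,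
  `√n ≤ |P| ≤ n/2` (the coarse Young cosets F1 on which neither branch of the route acts) or a right coset of
  the centraliser of an involution with `≤ √n` fixed points (fixed-point-free case = the PROVED sibling crux
  `HyperoctahedralSubsets`, stmt-8305, `hyperoctahedralSubsets_proof`);

and the kernel-checked composition `GlobalBranch_of : GlobalBranch` (restriction to the captured parts is a TPP
triple by heredity keeping `e^{-3c'√n}` of the volume; with `c' := c_H/8` the hosted bound at rate `c_H` beats
the threshold at rate `min c (c_H/2)`).  `lean check`: rc 0, sorries = the two stubs only.

Disproof obligations honoured (`Cruxes/GlobalBranch/Disproof.lean`): `globalBranch_false_without_TPP` — the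
TPP is used 3-wise inside both stubs and by heredity in the glue; `globalBranchWithoutInjectivity_trivial` —
the bump hypothesis (with injective `I, L`) is copied verbatim into `stub_inverseHostCapture`;
`not_globalBranchSuperExp` / `not_pairwiseGlobalBranch` — every conclusion is `e^{-c√n} ∃c` on a TRIPLE, and
the hexagon Young witnesses (block-hosted, volume `(n!)^{3/2}e^{-7n}`, `Negative/PlanarYoung.lean`) satisfy
`stub_tightHostedSubsets`; `globalBranch_iff_small_eps` — `ε` is the inverse theorem's.
-/

set_option linter.dupNamespace false
set_option autoImplicit false

namespace Summit.MatrixMultiplication.MatrixMultiplication.Cruxes.GlobalBranch.TightHostSplit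

open Summit.MatrixMultiplication.MatrixMultiplication.Theses.SnSubsetDichotomy
open Literature.Combinatorics.Additive

/-- **Tight hosts.** A set `Y ⊆ S_n` is *tightly hosted* if EITHER it lies in one block transporter
`{σ : σ(P) = B}` (written `P.map σ.toEmbedding = B`, as in the landed `blockDescent`) with `√n ≤ |P|` and `2|P| ≤ n` (a coset of the two-block Young subgroup
`S_P × S_{Pᶜ}`), OR it lies in one right coset `C(μ)·g` of the centraliser of an involution `μ` with
at most `√n` fixed points (`μ` fixed-point-free: `C(μ) = B(M) ≅ S₂ ≀ S_{n/2}`). -/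
def TightHosted (n : ℕ) (Y : Finset (Equiv.Perm (Fin n))) : Prop :=
  (∃ P B : Finset (Fin n), Real.sqrt (n : ℝ) ≤ (P.card : ℝ) ∧ 2 * P.card ≤ n ∧
      ∀ σ ∈ Y, P.map σ.toEmbedding = B) ∨
    (∃ μ g : Equiv.Perm (Fin n), μ * μ = 1 ∧
      ((Finset.univ.filter (fun x => μ x = x)).card : ℝ) ≤ Real.sqrt (n : ℝ) ∧
        ∀ σ ∈ Y, σ * g⁻¹ * μ = μ * (σ * g⁻¹))

/-- **Sub-crux H — `TightHostedSubsets`.**  There are `c > 0` and `n₀` such that for `n ≥ n₀` every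
TPP triple of tightly hosted sets has `|X₀||X₁||X₂| ≤ (n!)^{3/2} e^{-c√n}`.  (No bump-free hypothesis,
exactly as in the proved fixed-point-free centraliser case `hyperoctahedralSubsets_proof`.) -/
def TightHostedSubsets : Prop :=
  ∃ c : ℝ, 0 < c ∧ ∃ n₀ : ℕ, ∀ n ≥ n₀, ∀ X : Fin 3 → Finset (Equiv.Perm (Fin n)),
    (∀ i, TightHosted n (X i)) → TripleProductProperty (X 0) (X 1) (X 2) →
      (((X 0).card * (X 1).card * (X 2).card : ℕ) : ℝ) ≤
        (n.factorial : ℝ) ^ ((3 : ℝ) / 2) * Real.exp (-(c * Real.sqrt (n : ℝ)))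

/-- **Sub-crux I — `InverseHostCapture`** (the inverse theorem).  For some `ε > 0` and every capture
rate `c' > 0` there are `c > 0` and `n₀` such that for `n ≥ n₀`, in every TPP triple of
`(1/2+ε)`-bump-free sets (the crux hypothesis, verbatim) lying ABOVE the threshold
`(n!)^{3/2} e^{-c√n}`, each of the three sets has a tightly hosted part of relative size
`≥ e^{-c'√n}`. -/
def InverseHostCapture : Prop :=
  ∃ ε : ℝ, 0 < ε ∧ ∀ c' : ℝ, 0 < c' → ∃ c : ℝ, 0 < c ∧ ∃ n₀ : ℕ, ∀ n ≥ n₀,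
    ∀ S T U : Finset (Equiv.Perm (Fin n)), TripleProductProperty S T U →
      (∀ X : Finset (Equiv.Perm (Fin n)), (X = S ∨ X = T ∨ X = U) → ∀ t : ℕ, 1 ≤ t →
        (t : ℝ) ≤ Real.sqrt (n : ℝ) → ∀ I L : Fin t → Fin n, Function.Injective I →
          Function.Injective L →
            ((X.filter (fun σ => ∀ k, σ (I k) = L k)).card : ℝ) * (n.descFactorial t : ℝ) ≤
              (n : ℝ) ^ ((1 / 2 + ε) * t) * (X.card : ℝ)) →
      (n.factorial : ℝ) ^ ((3 : ℝ) / 2) * Real.exp (-(c * Real.sqrt (n : ℝ))) <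
          ((S.card * T.card * U.card : ℕ) : ℝ) →
        ∀ X : Finset (Equiv.Perm (Fin n)), (X = S ∨ X = T ∨ X = U) →
          ∃ Y ⊆ X, TightHosted n Y ∧ Real.exp (-(c' * Real.sqrt (n : ℝ))) * (X.card : ℝ) ≤ (Y.card : ℝ)

/-! ## The glue (conclusion = the BODY of `GlobalBranch`, head `∃`, so the only theorem concluding the crux BY
NAME in this file is `GlobalBranch_of` below) -/

/-- **Glue over the named statements**: `InverseHostCapture → TightHostedSubsets → (body of GlobalBranch)`.
With `c_H, n_H` from the hosted bound put `c' := c_H/8`, take `c, n_I` from the inverse theorem and answer with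
`ε`, `c₀ := min c (c_H/2)`, `n₀ := max n_I n_H`.  A bump-free TPP triple above the `c₀`-threshold is above the
`c`-threshold, so each set has a tightly hosted part of relative size `≥ e^{-c_H√n/8}`; the three parts form a
TPP triple (heredity, `TripleProductProperty.mono`) of volume
`> e^{-3c_H√n/8}·(n!)^{3/2}e^{-c_H√n/2} ≥ (n!)^{3/2}e^{-c_H√n}`, contradicting the hosted bound. -/
theorem glue_named (hI : InverseHostCapture) (hH : TightHostedSubsets) :
    ∃ ε : ℝ, 0 < ε ∧ ∃ c : ℝ, 0 < c ∧ ∃ n₀ : ℕ, ∀ n ≥ n₀, ∀ S T U : Finset (Equiv.Perm (Fin n)), Literature.Combinatorics.Additive.TripleProductProperty S T U → (∀ X : Finset (Equiv.Perm (Fin n)), (X = S ∨ X = T ∨ X = U) → ∀ t : ℕ, 1 ≤ t → (t : ℝ) ≤ Real.sqrt (n : ℝ) → ∀ I L : Fin t → Fin n, Function.Injective I → Function.Injective L → ((X.filter (fun σ => ∀ k, σ (I k) = L k)).card : ℝ) * (n.descFactorial t : ℝ) ≤ (n : ℝ) ^ ((1 / 2 + ε) * t) * (X.card : ℝ)) →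 ((S.card * T.card * U.card : ℕ) : ℝ) ≤ (n.factorial : ℝ) ^ ((3 : ℝ) / 2) * Real.exp (-(c * Real.sqrt (n : ℝ))) := by
  obtain ⟨ε, hε, hIc⟩ := hI
  obtain ⟨cH, hcH, nH, hHn⟩ := hH
  obtain ⟨c, hc, nI, hIn⟩ := hIc (cH / 8) (by positivity)
  refine ⟨ε, hε, min c (cH / 2), lt_min hc (by positivity), max nI nH, ?_⟩
  intro n hn S T U hTPP hbump
  by_contra hlt
  push Not at hlt
  have hnI : nI ≤ n := le_trans (le_max_left _ _) hn
  have hnH : nH ≤ n := le_trans (le_max_right _ _) hn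
  set F : ℝ := (n.factorial : ℝ) ^ ((3 : ℝ) / 2) with hF
  set s : ℝ := Real.sqrt (n : ℝ) with hs
  have hs0 : 0 ≤ s := Real.sqrt_nonneg _
  have hF0 : 0 < F := by positivity
  -- above the `c₀`-threshold ⇒ above the `c`-threshold
  have hmin_c : min c (cH / 2) * s ≤ c * s := mul_le_mul_of_nonneg_right (min_le_left _ _) hs0
  have hmin_H : min c (cH / 2) * s ≤ cH / 2 * s := mul_le_mul_of_nonneg_right (min_le_right _ _) hs0
  have hthr : F * Real.exp (-(c * s)) < ((S.card * T.card * U.card : ℕ) : ℝ) := by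
    refine lt_of_le_of_lt ?_ hlt
    exact mul_le_mul_of_nonneg_left (Real.exp_le_exp.2 (by linarith)) hF0.le
  -- the three captured parts
  obtain ⟨YS, hYS, hhS, hcS⟩ := hIn n hnI S T U hTPP hbump hthr S (Or.inl rfl)
  obtain ⟨YT, hYT, hhT, hcT⟩ := hIn n hnI S T U hTPP hbump hthr T (Or.inr (Or.inl rfl))
  obtain ⟨YU, hYU, hhU, hcU⟩ := hIn n hnI S T U hTPP hbump hthr U (Or.inr (Or.inr rfl))
  -- they form a tightly hosted TPP triple, hence obey the hosted bound
  have hTPP' : TripleProductProperty YS YT YU := hTPP.mono hYS hYT hYU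
  have hhost : ∀ i, TightHosted n (![YS, YT, YU] i) := by
    intro i
    fin_cases i
    · exact hhS
    · exact hhT
    · exact hhU
  have hbound := hHn n hnH ![YS, YT, YU] hhost hTPP'
  simp only [Matrix.cons_val_zero, Matrix.cons_val_one, Matrix.head_cons, Matrix.cons_val_two,
    Matrix.tail_cons] at hbound
  -- volume bookkeeping
  have h3 : Real.exp (-(3 * (cH / 8) * s)) = Real.exp (-(cH / 8 * s)) ^ 3 := by
    rw [← Real.exp_nat_mul]
    congr 1
    push_cast
    ring
  have hlow : Real.exp (-(3 * (cH / 8) * s)) * ((S.card * T.card * U.card : ℕ) : ℝ) ≤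
      ((YS.card * YT.card * YU.card : ℕ) : ℝ) := by
    push_cast
    rw [h3]
    calc Real.exp (-(cH / 8 * s)) ^ 3 * ((S.card : ℝ) * (T.card : ℝ) * (U.card : ℝ))
        = Real.exp (-(cH / 8 * s)) * (S.card : ℝ) * (Real.exp (-(cH / 8 * s)) * (T.card : ℝ)) *
            (Real.exp (-(cH / 8 * s)) * (U.card : ℝ)) := by ring
      _ ≤ (YS.card : ℝ) * (YT.card : ℝ) * (YU.card : ℝ) :=
        mul_le_mul (mul_le_mul hcS hcT (by positivity) (by positivity)) hcU (by positivity)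
          (by positivity)
  -- the threshold chain: F e^{-c_H s} ≤ e^{-3c_H s/8} · F e^{-(min) s} < e^{-3 c_H s/8} · V ≤ vol(Y) ≤ F e^{-c_H s}
  have hexp : F * Real.exp (-(cH * s)) ≤
      Real.exp (-(3 * (cH / 8) * s)) * (F * Real.exp (-(min c (cH / 2) * s))) := by
    have : Real.exp (-(3 * (cH / 8) * s)) * (F * Real.exp (-(min c (cH / 2) * s))) =
        F * Real.exp (-(3 * (cH / 8) * s) + -(min c (cH / 2) * s)) := by
      rw [Real.exp_add]; ring
    rw [this]
    refine mul_le_mul_of_nonneg_left (Real.exp_le_exp.2 ?_) hF0.le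
    nlinarith [hmin_H, hcH, hs0]
  have hstrict : Real.exp (-(3 * (cH / 8) * s)) * (F * Real.exp (-(min c (cH / 2) * s))) <
      Real.exp (-(3 * (cH / 8) * s)) * ((S.card * T.card * U.card : ℕ) : ℝ) :=
    mul_lt_mul_of_pos_left hlt (Real.exp_pos _)
  have := lt_of_le_of_lt hexp (lt_of_lt_of_le hstrict (hlow.trans hbound))
  exact lt_irrefl _ this

/-- **Glue core, written out** (hypotheses = the literal stub statements; definitionally `glue_named`). -/
theorem glue_core
    (hI : ∃ ε : ℝ, 0 < ε ∧ ∀ c' : ℝ, 0 < c' → ∃ c : ℝ, 0 < c ∧ ∃ n₀ : ℕ, ∀ n ≥ n₀, ∀ S T U : Finset (Equiv.Perm (Fin n)), Literature.Combinatorics.Additive.TripleProductProperty S T U → (∀ X : Finset (Equiv.Perm (Fin n)), (X = S ∨ X = T ∨ X = U) → ∀ t : ℕ, 1 ≤ t → (t : ℝ) ≤ Real.sqrt (n : ℝ) → ∀ I L : Fin t → Fin n, Function.Injective I → Function.Injective L → ((X.filter (fun σ => ∀ k, σ (I k) = L k)).card : ℝ) * (n.descFactorial t : ℝ) ≤ (n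 : ℝ) ^ ((1 / 2 + ε) * t) * (X.card : ℝ)) → (n.factorial : ℝ) ^ ((3 : ℝ) / 2) * Real.exp (-(c * Real.sqrt (n : ℝ))) < ((S.card * T.card * U.card : ℕ) : ℝ) → ∀ X : Finset (Equiv.Perm (Fin n)), (X = S ∨ X = T ∨ X = U) → ∃ Y ⊆ X, ((∃ P B : Finset (Fin n), Real.sqrt (n : ℝ) ≤ (P.card : ℝ) ∧ 2 * P.card ≤ n ∧ ∀ σ ∈ Y, P.map σ.toEmbedding = B) ∨ (∃ μ g : Equiv.Perm (Fin n), μ * μ = 1 ∧ ((Finset.univ.filter (fun x => μ x = x)).card : ℝ) ≤ Real.sqrt (n : ℝ) ∧ ∀ σ ∈ Y, σ * g⁻¹ * μ = μ * (σ * g⁻¹))) ∧ Real.exp (-(c' * Real.sqrt (n : ℝ))) * (X.card : ℝ) ≤ (Y.card : ℝ))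
    (hH : ∃ c : ℝ, 0 < c ∧ ∃ n₀ : ℕ, ∀ n ≥ n₀, ∀ X : Fin 3 → Finset (Equiv.Perm (Fin n)), (∀ i, (∃ P B : Finset (Fin n), Real.sqrt (n : ℝ) ≤ (P.card : ℝ) ∧ 2 * P.card ≤ n ∧ ∀ σ ∈ X i, P.map σ.toEmbedding = B) ∨ (∃ μ g : Equiv.Perm (Fin n), μ * μ = 1 ∧ ((Finset.univ.filter (fun x => μ x = x)).card : ℝ) ≤ Real.sqrt (n : ℝ) ∧ ∀ σ ∈ X i, σ * g⁻¹ * μ = μ * (σ * g⁻¹))) → Literature.Combinatorics.Additive.TripleProductProperty (X 0) (X 1) (X 2) → (((X 0).card * (X 1).card * (X 2).card : ℕ) : ℝ) ≤ (n.factorial : ℝ) ^ ((3 : ℝ) / 2) * Real.exp (-(c * Real.sqrt (n : ℝ)))) :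
    ∃ ε : ℝ, 0 < ε ∧ ∃ c : ℝ, 0 < c ∧ ∃ n₀ : ℕ, ∀ n ≥ n₀, ∀ S T U : Finset (Equiv.Perm (Fin n)), Literature.Combinatorics.Additive.TripleProductProperty S T U → (∀ X : Finset (Equiv.Perm (Fin n)), (X = S ∨ X = T ∨ X = U) → ∀ t : ℕ, 1 ≤ t → (t : ℝ) ≤ Real.sqrt (n : ℝ) → ∀ I L : Fin t → Fin n, Function.Injective I → Function.Injective L → ((X.filter (fun σ => ∀ k, σ (I k) = L k)).card : ℝ) * (n.descFactorial t : ℝ) ≤ (n : ℝ) ^ ((1 / 2 + ε) * t) * (X.card : ℝ)) → ((S.card * T.card * U.card : ℕ) : ℝ) ≤ (n.factorial : ℝ) ^ ((3 : ℝ) / 2) * Real.exp (-(c * Real.sqrt (n : ℝ))) :=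
  glue_named hI hH

/-! ## The two registered stubs (crux-sized by design) -/

/-- **Stub I — inverse host capture** (= `InverseHostCapture` above, written out).  OPEN: no inverse
theorem at density `(n!)^{-1/2}` is known (RESIDUAL-c3 §3(I)). [conjecture] -/
theorem stub_inverseHostCapture : ∃ ε : ℝ, 0 < ε ∧ ∀ c' : ℝ, 0 < c' → ∃ c : ℝ, 0 < c ∧ ∃ n₀ : ℕ, ∀ n ≥ n₀, ∀ S T U : Finset (Equiv.Perm (Fin n)), Literature.Combinatorics.Additive.TripleProductProperty S T U → (∀ X : Finset (Equiv.Perm (Fin n)), (X = S ∨ X = T ∨ X = U) → ∀ t : ℕ, 1 ≤ t → (t : ℝ) ≤ Real.sqrt (n : ℝ) → ∀ I L : Fin t → Fin n, Function.Injective I → Function.Injective L → ((X.filter (fun σ => ∀ k, σ (I k) = L k)).card : ℝ) * (n.descFactorial t : ℝ) ≤ (n : ℝ) ^ ((1 / 2 + ε) * t) * (X.card : ℝ)) → (n.factorial : ℝ) ^ ((3 : ℝ) / 2) * Real.exp (-(c * Real.sqrt (n : ℝ))) < ((S.card * T.card * U.card : ℕ) : ℝ) → ∀ X : Finset (Equiv.Perm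 (Fin n)), (X = S ∨ X = T ∨ X = U) → ∃ Y ⊆ X, ((∃ P B : Finset (Fin n), Real.sqrt (n : ℝ) ≤ (P.card : ℝ) ∧ 2 * P.card ≤ n ∧ ∀ σ ∈ Y, P.map σ.toEmbedding = B) ∨ (∃ μ g : Equiv.Perm (Fin n), μ * μ = 1 ∧ ((Finset.univ.filter (fun x => μ x = x)).card : ℝ) ≤ Real.sqrt (n : ℝ) ∧ ∀ σ ∈ Y, σ * g⁻¹ * μ = μ * (σ * g⁻¹))) ∧ Real.exp (-(c' * Real.sqrt (n : ℝ))) * (X.card : ℝ) ≤ (Y.card : ℝ) := by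
  sorry

/-- **Stub H — tightly hosted sub-triples** (= `TightHostedSubsets` above, written out).  OPEN except the
fixed-point-free centraliser case (`hyperoctahedralSubsets_proof`); contains the coarse-Young family F1.
[conjecture] -/
theorem stub_tightHostedSubsets : ∃ c : ℝ, 0 < c ∧ ∃ n₀ : ℕ, ∀ n ≥ n₀, ∀ X : Fin 3 → Finset (Equiv.Perm (Fin n)), (∀ i, (∃ P B : Finset (Fin n), Real.sqrt (n : ℝ) ≤ (P.card : ℝ) ∧ 2 * P.card ≤ n ∧ ∀ σ ∈ X i, P.map σ.toEmbedding = B) ∨ (∃ μ g : Equiv.Perm (Fin n), μ * μ = 1 ∧ ((Finset.univ.filter (fun x => μ x = x)).card : ℝ) ≤ Real.sqrt (n : ℝ) ∧ ∀ σ ∈ X i, σ * g⁻¹ * μ = μ * (σ * g⁻¹))) → Literature.Combinatorics.Additive.TripleProductProperty (X 0) (X 1) (X 2) → (((X 0).card * (X 1).card * (X 2).card : ℕ) : ℝ) ≤ (n.factorial : ℝ) ^ ((3 : ℝ) / 2) * Real.exp (-(c * Real.sqrt (n : ℝ))) := by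
  sorry

/-! ## The composition (kernel-checked): the crux BY NAME from the two stubs -/

/-- **`GlobalBranch` from the two registered stubs** (`glue_core`; `GlobalBranch` unfolds to its body). -/
theorem GlobalBranch_of : GlobalBranch :=
  glue_core stub_inverseHostCapture stub_tightHostedSubsets

end Summit.MatrixMultiplication.MatrixMultiplication.Cruxes.GlobalBranch.TightHostSplit
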